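import Mathlib
import Summits.Ventures.PercRepro2.StepZeroOfAS3

/-!
# (AS3) for events generated by pairwise disjoint sets  (seat mine-b, cell pub-perc-repro2)

The level-refined Reimer statement `AS3 U A B` (`StepZeroOfAS3.lean`, conjectured for all increasing
`A`, `B`) is proved here when `B` is generated by a family `𝒲` of pairwise disjoint nonempty sets,
`B γ ⟺ ∃ W ∈ 𝒲, W ⊆ γ` (`AS3_of_pairwiseDisjoint`), for every `A`.  The injection is the
hand-over of one generator: a source `γ` (disjoint witnesses `K` of `A` and `L ⊇ W` of `B`, with `U \ γ`
containing no generator) goes to `γ \ W`; the red side `(U \ γ) ∪ W` then contains exactly one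
generator, because two disjoint generators inside it would both have to meet `W`, and distinct
generators are disjoint.  Two sources `δ ∪ W ≠ δ ∪ W'` cannot share the target `δ`: `W'` would lie
entirely in the red side of `δ ∪ W`.

Graph reading (via `stepH_zero_of_AS3`): STEP(0, j) on every pattern `(O, Y)` whose blue
`s–t` paths have pairwise disjoint `Y`-parts — e.g. every pattern of a parallel composition of
strands of edge-connectivity 1 (theta graphs), or of any graph in which the `Y`-edges of different
`s–t` paths are disjoint.
-/

open Finset

namespace Summit.Ventures.PercRepro2

namespace StepZero

open ReimerCube

variable {E : Type*} [DecidableEq E]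

/-- the event generated by a family of sets: `γ` contains a member of `𝒲` -/
def genBy (𝒲 : Finset (Finset E)) : Finset E → Prop := fun γ => ∃ W ∈ 𝒲, W ⊆ γ

omit [DecidableEq E] in
/-- `genBy 𝒲` is increasing -/
lemma incr_genBy (𝒲 : Finset (Finset E)) : Incr (genBy 𝒲) := by
  intro S T hST ⟨W, hW, hWS⟩
  exact ⟨W, hW, hWS.trans hST⟩

omit [DecidableEq E] in
/-- a cylinder witness of `genBy 𝒲` contains a generator -/
lemma genBy_of_cyl {𝒲 : Finset (Finset E)} {K : Finset E} (h : ∀ T, K ⊆ T → genBy 𝒲 T) :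
    ∃ W ∈ 𝒲, W ⊆ K :=
  h K le_rfl

open Classical in
/-- **(AS3) for `B` generated by pairwise disjoint nonempty sets**, for every event `A`
(monotonicity of `A` is not even needed). -/
theorem AS3_of_pairwiseDisjoint (U : Finset E) (A : Finset E → Prop)
    (𝒲 : Finset (Finset E)) (hne : ∀ W ∈ 𝒲, W.Nonempty)
    (hdisj : ∀ W ∈ 𝒲, ∀ W' ∈ 𝒲, W ≠ W' → Disjoint W W') :
    AS3 U A (genBy 𝒲) := by
  unfold AS3
  -- the hand-over: for a source `γ`, some generator `W ⊆ γ` with `A (γ \ W)`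
  have hsrc : ∀ γ ∈ U.powerset.filter (fun γ => DOcc A (genBy 𝒲) γ ∧ ¬ genBy 𝒲 (U \ γ)),
      ∃ W ∈ 𝒲, W ⊆ γ ∧ A (γ \ W) := by
    intro γ hγ
    rw [Finset.mem_filter] at hγ
    obtain ⟨-, ⟨K, L, hK, hL, hKL, hAK, hBL⟩, -⟩ := hγ
    obtain ⟨W, hW, hWL⟩ := genBy_of_cyl hBL
    refine ⟨W, hW, hWL.trans hL, hAK _ ?_⟩
    intro x hx
    rw [Finset.mem_sdiff]
    exact ⟨hK hx, fun hxW => Finset.disjoint_left.mp hKL hx (hWL hxW)⟩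
  -- the map
  let f : Finset E → Finset E := fun γ =>
    if h : ∃ W ∈ 𝒲, W ⊆ γ ∧ A (γ \ W) then γ \ Classical.choose h else γ
  have hf : ∀ γ, (∃ W ∈ 𝒲, W ⊆ γ ∧ A (γ \ W)) →
      ∃ W ∈ 𝒲, W ⊆ γ ∧ A (γ \ W) ∧ f γ = γ \ W := by
    intro γ h
    refine ⟨Classical.choose h, (Classical.choose_spec h).1, (Classical.choose_spec h).2.1,
      (Classical.choose_spec h).2.2, ?_⟩
    simp only [f, dif_pos h]
  apply Finset.card_le_card_of_injOn f
  · -- maps sources into targets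
    intro γ hγ
    obtain ⟨W, hW, hWγ, hAγ, hfγ⟩ := hf γ (hsrc γ hγ)
    rw [Finset.mem_coe, Finset.mem_filter] at hγ ⊢
    obtain ⟨hγU, -, hnot⟩ := hγ
    rw [hfγ]
    have hγU' := Finset.mem_powerset.mp hγU
    refine ⟨Finset.mem_powerset.mpr (Finset.sdiff_subset.trans hγU'), hAγ, ?_, ?_⟩
    · -- the red side `U \ (γ \ W) ⊇ W` contains a generator
      refine ⟨W, hW, ?_⟩
      intro x hx
      rw [Finset.mem_sdiff, Finset.mem_sdiff]
      exact ⟨hγU' (hWγ hx), fun h => h.2 hx⟩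
    · -- but no two disjoint generators
      rintro ⟨K₁, L₁, hK₁, hL₁, hKL, hB₁, hB₂⟩
      obtain ⟨W₁, hW₁, hW₁K⟩ := genBy_of_cyl hB₁
      obtain ⟨W₂, hW₂, hW₂L⟩ := genBy_of_cyl hB₂
      -- every generator inside `U \ (γ \ W)` meets `W`, hence equals `W`
      have key : ∀ W' ∈ 𝒲, W' ⊆ U \ (γ \ W) → W' = W := by
        intro W' hW' hW'sub
        by_contra hne'
        apply hnot
        refine ⟨W', hW', ?_⟩
        intro x hx
        have hx' := hW'sub hx
        rw [Finset.mem_sdiff] at hx' ⊢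
        refine ⟨hx'.1, fun hxγ => hx'.2 ?_⟩
        rw [Finset.mem_sdiff]
        exact ⟨hxγ, fun hxW => Finset.disjoint_left.mp (hdisj W' hW' W hW hne') hx hxW⟩
      have e₁ := key W₁ hW₁ (hW₁K.trans hK₁)
      have e₂ := key W₂ hW₂ (hW₂L.trans hL₁)
      obtain ⟨x, hx⟩ := hne W hW
      have hx₁ : x ∈ K₁ := hW₁K (e₁ ▸ hx)
      have hx₂ : x ∈ L₁ := hW₂L (e₂ ▸ hx)
      exact Finset.disjoint_left.mp hKL hx₁ hx₂
  · -- injective on the sources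
    intro γ hγ γ' hγ' heq
    obtain ⟨W, hW, hWγ, -, hfγ⟩ := hf γ (hsrc γ hγ)
    obtain ⟨W', hW', hWγ', -, hfγ'⟩ := hf γ' (hsrc γ' hγ')
    rw [hfγ, hfγ'] at heq
    rw [Finset.mem_coe, Finset.mem_filter] at hγ hγ'
    by_cases hWW : W = W'
    · subst hWW
      -- `γ = (γ \ W) ∪ W = (γ' \ W) ∪ W = γ'`
      have h1 : γ = (γ \ W) ∪ W := by
        rw [Finset.sdiff_union_of_subset hWγ]
      have h2 : γ' = (γ' \ W) ∪ W := by
        rw [Finset.sdiff_union_of_subset hWγ']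
      rw [h1, h2, heq]
    · exfalso
      -- `W'` is disjoint from `γ`: it misses `γ \ W` (since `γ' \ W' = γ \ W` and `W' ∩ (γ' \ W') = ∅`)
      -- and misses `W`; so `W' ⊆ U \ γ`, contradicting `¬ genBy 𝒲 (U \ γ)`
      apply hγ.2.2
      refine ⟨W', hW', ?_⟩
      intro x hx
      rw [Finset.mem_sdiff]
      refine ⟨Finset.mem_powerset.mp hγ'.1 (hWγ' hx), fun hxγ => ?_⟩
      by_cases hxW : x ∈ W
      · exact Finset.disjoint_left.mp (hdisj W hW W' hW' hWW) hxW hx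
      · have hx1 : x ∈ γ \ W := Finset.mem_sdiff.mpr ⟨hxγ, hxW⟩
        rw [heq, Finset.mem_sdiff] at hx1
        exact hx1.2 hx

section Graph

variable {V : Type*}

/-- **STEP(0, j+1) on every pattern `(O, Y)` whose pinned connection event is generated by pairwise
disjoint nonempty sets** (the `Y`-parts of the `s–t` paths through `O` are pairwise disjoint, e.g. every
pattern of a theta graph): `H(0, j+1) ≤ H(1, j)`. -/
theorem stepH_zero_of_disjoint_paths (ends : E → Sym2 V) (s t : V) (O Y : Finset E) (j : ℕ)
    (𝒲 : Finset (Finset E)) (hB : pinCarries ends s t O = genBy 𝒲) (hne : ∀ W ∈ 𝒲, W.Nonempty)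
    (hdisj : ∀ W ∈ 𝒲, ∀ W' ∈ 𝒲, W ≠ W' → Disjoint W W') :
    stepH ends s t O Y 0 (j + 1) ≤ stepH ends s t O Y 1 j := by
  apply stepH_zero_of_AS3
  rw [hB]
  exact AS3_of_pairwiseDisjoint Y (pinFlow ends s t O j) 𝒲 hne hdisj

end Graph

end StepZero

end Summit.Ventures.PercRepro2
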